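import Mathlib.Analysis.Calculus.Deriv.Slope
import Literature.Analysis.ODE.SoninEnvelope
import HarnessLib

/-!
# The Sonin–Pólya energy across a piecewise-monotone coefficient

Topic `Literature/Analysis/ODE` (namespace `Literature.Analysis.ODE`). A priori TWO-SIDED control
of complex solutions of `u″ = −φ(x) u` (`φ` real, differentiable, bounded between two positive
constants `0 < φmin ≤ φ ≤ φmax`) through a classically allowed region on which `φ` is only
piecewise monotone, with a polynomial constant and no large-parameter (Liouville–Green / WKB)
machinery:

* `soninEnergy_le_mul_ratio` — ONE monotone stretch `[α, β]`, either direction and either order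
  of the two points: `E(y) ≤ (φmax/φmin) · E(x)` for the Sonin–Pólya energy `E = φ|u|² + |u′|²`.
  Moving in the direction in which `φ` decreases, `E` itself decreases
  (`soninEnergy_antitoneOn` of `SoninEnvelope.lean`); moving in the direction in which `φ`
  increases, the envelope `N = |u|² + |u′|²/φ` decreases (`soninEnvelope_antitoneOn`, Sonin's
  theorem) and `E = φ N`, which costs the factor `φ(y)/φ(x) ≤ φmax/φmin`
  (`mul_add_le_ratio_mul_of_envelope_le`).
* `soninEnergy_le_pow_ratio` — a partition `t 0 ≤ t 1 ≤ ⋯ ≤ t k` with `φ` monotone on each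
  `[t i, t (i+1)]`: `E(y) ≤ (φmax/φmin)^k · E(x)` for all `x, y ∈ [t 0, t k]`, by induction on the
  number of stretches through the partition points.

The sign of `φ′` on a CLOSED stretch, endpoints included, is read off from monotonicity through
one-sided difference quotients (`nonneg_of_monotoneOn_Icc`, `nonpos_of_antitoneOn_Icc`, from
Mathlib's `HasDerivWithinAt.nonneg_of_monotoneOn` and the fact `accPt_principal_Icc` that every
point of a nondegenerate closed interval is an accumulation point of it); the degenerate stretch
`α = β` carries no sign information and is treated separately (`x = y`).

Hypotheses are pointwise `HasDerivAt` statements on closed intervals for `u, u′ : ℝ → ℂ` and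
`φ, φ′ : ℝ → ℝ`, as in `SoninEnvelope.lean`. Everything is proved. Used toward the cone
Green-kernel bound of the near-extremal Kerr programme (Carter's radial potential has at most
seven critical points outside the horizon, so an allowed region away from its turning points is a
union of at most eight monotone stretches and the losses are polynomial).

## References
* G. Szegő, *Orthogonal Polynomials*, AMS Colloquium Publ. 23, 4th ed. (1975), §7.31,
  Theorem 7.31.1 (Sonin–Pólya: monotonicity of the successive maxima of `|u|`).
* F. W. J. Olver, *Asymptotics and Special Functions* (Academic Press 1974), Ch. 6 §§1–2 (the
  Liouville–Green approximation for `u″ = −φ u` in an oscillatory interval, whose error bounds the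
  present elementary comparison replaces when only polynomial constants matter). Key `Olver1974`.
-/

noncomputable section

open Set Filter Topology

namespace Literature.Analysis.ODE

/-! ### The sign of the derivative of a monotone function on a closed interval -/

/-- Every point of a nondegenerate closed interval `[α, β]` (`α < β`), endpoints included, is an
accumulation point of `[α, β]`. [folklore] -/
theorem accPt_principal_Icc {α β x : ℝ} (hαβ : α < β) (hx : x ∈ Icc α β) :
    AccPt x (𝓟 (Icc α β)) := by
  rw [accPt_principal_iff_nhdsWithin, ← mem_closure_iff_nhdsWithin_neBot]
  rcases lt_or_eq_of_le hx.2 with hlt | heq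
  · -- `x < β`: approach from the right inside `(x, β)`
    have h1 : Ioo x β ⊆ Icc α β \ {x} := fun z hz =>
      ⟨⟨hx.1.trans hz.1.le, hz.2.le⟩, fun h => (ne_of_gt hz.1) h⟩
    refine closure_mono h1 ?_
    rw [closure_Ioo hlt.ne]
    exact left_mem_Icc.2 hlt.le
  · -- `x = β`: approach from the left inside `(α, β)`
    rw [heq]
    have h1 : Ioo α β ⊆ Icc α β \ {β} := fun z hz =>
      ⟨⟨hz.1.le, hz.2.le⟩, fun h => (ne_of_lt hz.2) h⟩
    refine closure_mono h1 ?_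
    rw [closure_Ioo hαβ.ne]
    exact right_mem_Icc.2 hαβ.le

/-- If `φ` is non-decreasing on a nondegenerate closed interval `[α, β]` and has derivative `φ′`
at a point `x ∈ [α, β]` (endpoints included), then `0 ≤ φ′`: the difference quotients from inside
the interval are nonnegative. [folklore] -/
theorem nonneg_of_monotoneOn_Icc {φ : ℝ → ℝ} {φ' α β x : ℝ} (hαβ : α < β)
    (hmono : MonotoneOn φ (Icc α β)) (hx : x ∈ Icc α β) (hφ : HasDerivAt φ φ' x) : 0 ≤ φ' :=
  hφ.hasDerivWithinAt.nonneg_of_monotoneOn (accPt_principal_Icc hαβ hx) hmono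

/-- If `φ` is non-increasing on a nondegenerate closed interval `[α, β]` and has derivative `φ′`
at a point `x ∈ [α, β]` (endpoints included), then `φ′ ≤ 0`. [folklore] -/
theorem nonpos_of_antitoneOn_Icc {φ : ℝ → ℝ} {φ' α β x : ℝ} (hαβ : α < β)
    (hanti : AntitoneOn φ (Icc α β)) (hx : x ∈ Icc α β) (hφ : HasDerivAt φ φ' x) : φ' ≤ 0 :=
  hφ.hasDerivWithinAt.nonpos_of_antitoneOn (accPt_principal_Icc hαβ hx) hanti

/-! ### One monotone stretch -/

/-- **From the envelope to the energy.** The bookkeeping behind the direction of increasing `φ`: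
if `A + B/p ≤ C + D/q` (envelope comparison, `A = |u(y)|²`, `B = |u′(y)|²`, `C = |u(x)|²`,
`D = |u′(x)|²`, `p = φ(y)`, `q = φ(x)`) with `C, D ≥ 0` and `0 < φmin ≤ p ≤ φmax`, `φmin ≤ q`,
then `p A + B ≤ (φmax/φmin)(q C + D)`, because `p A + B = p (A + B/p) ≤ p (C + D/q)
= (p/q)(q C + D)` and `p/q ≤ φmax/φmin`. [folklore] -/
theorem mul_add_le_ratio_mul_of_envelope_le {A B C D p q φmin φmax : ℝ}
    (hN : A + B / p ≤ C + D / q) (hC : 0 ≤ C) (hD : 0 ≤ D) (hmin : 0 < φmin)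
    (hp : φmin ≤ p) (hp' : p ≤ φmax) (hq : φmin ≤ q) :
    p * A + B ≤ φmax / φmin * (q * C + D) := by
  have hp0 : 0 < p := hmin.trans_le hp
  have hq0 : 0 < q := hmin.trans_le hq
  have h1 : p * (A + B / p) ≤ p * (C + D / q) := mul_le_mul_of_nonneg_left hN hp0.le
  have e1 : p * (A + B / p) = p * A + B := by field_simp
  have e2 : p * (C + D / q) = p / q * (q * C + D) := by field_simp
  have h3 : p / q ≤ φmax / φmin := div_le_div₀ (hmin.le.trans (hp.trans hp')) hp' hmin hq
  have h4 : p / q * (q * C + D) ≤ φmax / φmin * (q * C + D) :=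
    mul_le_mul_of_nonneg_right h3 (add_nonneg (mul_nonneg hq0.le hC) hD)
  linarith

/-- **Sonin energy across one monotone stretch, either direction.** Let `u″ = −φ u` on `[α, β]`
with `φ` differentiable, monotone (non-decreasing OR non-increasing) and `0 < φmin ≤ φ ≤ φmax`
there. Then for ANY two points `x, y ∈ [α, β]` (in either order) the Sonin–Pólya energy
`E = φ|u|² + |u′|²` satisfies `E(y) ≤ (φmax/φmin) · E(x)`. In the direction in which `φ`
decreases `E` is non-increasing (`E′ = φ′|u|²`); in the direction in which `φ` increases the
envelope `N = |u|² + |u′|²/φ` is non-increasing (`N′ = −φ′|u′|²/φ²`, Sonin's theorem) and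
`E = φ N` loses at most the factor `φ(y)/φ(x) ≤ φmax/φmin`. [folklore] -/
theorem soninEnergy_le_mul_ratio {u u' : ℝ → ℂ} {φ φ' : ℝ → ℝ} {α β φmin φmax : ℝ}
    (hu : ∀ x ∈ Icc α β, HasDerivAt u (u' x) x ∧ HasDerivAt u' (-((φ x : ℂ) * u x)) x)
    (hφ : ∀ x ∈ Icc α β, HasDerivAt φ (φ' x) x)
    (hmono : MonotoneOn φ (Icc α β) ∨ AntitoneOn φ (Icc α β))
    (hmin : 0 < φmin) (hbd : ∀ x ∈ Icc α β, φmin ≤ φ x ∧ φ x ≤ φmax) {x y : ℝ}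
    (hx : x ∈ Icc α β) (hy : y ∈ Icc α β) :
    φ y * ‖u y‖ ^ 2 + ‖u' y‖ ^ 2 ≤ (φmax / φmin) * (φ x * ‖u x‖ ^ 2 + ‖u' x‖ ^ 2) := by
  -- `φ > 0` on the stretch, the ratio is `≥ 1`, the energy at `x` is `≥ 0`
  have hpos : ∀ z ∈ Icc α β, 0 < φ z := fun z hz => hmin.trans_le (hbd z hz).1
  have hr : 1 ≤ φmax / φmin := (one_le_div hmin).2 ((hbd x hx).1.trans (hbd x hx).2)
  have hEx : 0 ≤ φ x * ‖u x‖ ^ 2 + ‖u' x‖ ^ 2 :=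
    add_nonneg (mul_nonneg (hpos x hx).le (sq_nonneg _)) (sq_nonneg _)
  -- the energy direction: `E y ≤ E x` suffices
  have hA : φ y * ‖u y‖ ^ 2 + ‖u' y‖ ^ 2 ≤ φ x * ‖u x‖ ^ 2 + ‖u' x‖ ^ 2 →
      φ y * ‖u y‖ ^ 2 + ‖u' y‖ ^ 2 ≤ (φmax / φmin) * (φ x * ‖u x‖ ^ 2 + ‖u' x‖ ^ 2) :=
    fun h => h.trans (le_mul_of_one_le_left hEx hr)
  -- the envelope direction: `N y ≤ N x` suffices
  have hB : ‖u y‖ ^ 2 + ‖u' y‖ ^ 2 / φ y ≤ ‖u x‖ ^ 2 + ‖u' x‖ ^ 2 / φ x →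
      φ y * ‖u y‖ ^ 2 + ‖u' y‖ ^ 2 ≤ (φmax / φmin) * (φ x * ‖u x‖ ^ 2 + ‖u' x‖ ^ 2) :=
    fun h => mul_add_le_ratio_mul_of_envelope_le h (sq_nonneg _) (sq_nonneg _) hmin (hbd y hy).1
      (hbd y hy).2 (hbd x hx).1
  -- the degenerate case `x = y` (which covers the degenerate stretch `α = β`)
  rcases eq_or_ne x y with rfl | hne
  · exact hA le_rfl
  have hαβ : α < β := lt_of_le_of_ne (hx.1.trans hx.2) fun h =>
    hne (le_antisymm (by linarith [hx.2, hy.1]) (by linarith [hy.2, hx.1]))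
  -- the solution data in the form consumed by `SoninEnvelope.lean`
  have h : ∀ z ∈ Icc α β, HasDerivAt u (u' z) z ∧ HasDerivAt u' (-(φ z : ℂ) * u z) z ∧
      HasDerivAt φ (φ' z) z :=
    fun z hz => ⟨(hu z hz).1, by rw [neg_mul]; exact (hu z hz).2, hφ z hz⟩
  rcases hmono with hmn | han
  · -- `φ` non-decreasing: `φ′ ≥ 0`, `E` non-decreasing, `N` non-increasing
    have hφ' : ∀ z ∈ Icc α β, 0 ≤ φ' z :=
      fun z hz => nonneg_of_monotoneOn_Icc hαβ hmn hz (hφ z hz)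
    rcases le_total y x with hyx | hxy
    · exact hA (soninEnergy_le_of_ge h hφ' hy hx hyx)
    · exact hB (soninEnvelope_antitoneOn h hpos hφ' hx hy hxy)
  · -- `φ` non-increasing: `φ′ ≤ 0`, `E` non-increasing, `N` non-decreasing
    have hφ' : ∀ z ∈ Icc α β, φ' z ≤ 0 :=
      fun z hz => nonpos_of_antitoneOn_Icc hαβ han hz (hφ z hz)
    rcases le_total x y with hxy | hyx
    · exact hA (soninEnergy_le_of_le h hφ' hx hy hxy)
    · exact hB (soninEnvelope_monotoneOn h hpos hφ' hy hx hyx)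

/-! ### Finitely many monotone stretches -/

/-- **Sonin energy across a piecewise-monotone coefficient.** Let `t 0 ≤ t 1 ≤ ⋯ ≤ t k` be a
partition of `[t 0, t k]`, let `u″ = −φ u` on `[t 0, t k]` with `φ` differentiable and
`0 < φmin ≤ φ ≤ φmax` there, and suppose `φ` is monotone (non-decreasing or non-increasing) on
each stretch `[t i, t (i+1)]`, `i < k`. Then for any two points `x, y ∈ [t 0, t k]` the
Sonin–Pólya energy `E = φ|u|² + |u′|²` satisfies `E(y) ≤ (φmax/φmin)^k · E(x)`: each stretch
costs at most one factor `φmax/φmin ≥ 1` (`soninEnergy_le_mul_ratio`), by induction on the number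
of stretches through the partition points. For `k = 0` the interval is a point and the bound is an
equality. [folklore] -/
theorem soninEnergy_le_pow_ratio {u u' : ℝ → ℂ} {φ φ' : ℝ → ℝ} {φmin φmax : ℝ} {k : ℕ}
    (t : ℕ → ℝ) (ht : ∀ i < k, t i ≤ t (i + 1))
    (hu : ∀ x ∈ Icc (t 0) (t k), HasDerivAt u (u' x) x ∧ HasDerivAt u' (-((φ x : ℂ) * u x)) x)
    (hφ : ∀ x ∈ Icc (t 0) (t k), HasDerivAt φ (φ' x) x)
    (hmono : ∀ i < k, MonotoneOn φ (Icc (t i) (t (i + 1))) ∨ AntitoneOn φ (Icc (t i) (t (i + 1))))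
    (hmin : 0 < φmin) (hbd : ∀ x ∈ Icc (t 0) (t k), φmin ≤ φ x ∧ φ x ≤ φmax) {x y : ℝ}
    (hx : x ∈ Icc (t 0) (t k)) (hy : y ∈ Icc (t 0) (t k)) :
    φ y * ‖u y‖ ^ 2 + ‖u' y‖ ^ 2 ≤ (φmax / φmin) ^ k * (φ x * ‖u x‖ ^ 2 + ‖u' x‖ ^ 2) := by
  -- the partition is monotone up to `k`
  have htm : ∀ j ≤ k, ∀ i ≤ j, t i ≤ t j := by
    intro j
    induction j with
    | zero => intro _ i hi; rw [Nat.le_zero.1 hi]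
    | succ j ih =>
      intro hj i hi
      rcases Nat.of_le_succ hi with h | h
      · exact (ih (Nat.le_of_succ_le hj) i h).trans (ht j hj)
      · rw [h]
  -- the ratio is `≥ 1`, energies are `≥ 0`
  have hr : 1 ≤ φmax / φmin := (one_le_div hmin).2 ((hbd x hx).1.trans (hbd x hx).2)
  have hr0 : 0 ≤ φmax / φmin := zero_le_one.trans hr
  have hE0 : ∀ z ∈ Icc (t 0) (t k), 0 ≤ φ z * ‖u z‖ ^ 2 + ‖u' z‖ ^ 2 := fun z hz =>
    add_nonneg (mul_nonneg (hmin.trans_le (hbd z hz).1).le (sq_nonneg _)) (sq_nonneg _)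
  -- one stretch of the partition
  have hone : ∀ i < k, ∀ a ∈ Icc (t i) (t (i + 1)), ∀ b ∈ Icc (t i) (t (i + 1)),
      φ b * ‖u b‖ ^ 2 + ‖u' b‖ ^ 2 ≤ φmax / φmin * (φ a * ‖u a‖ ^ 2 + ‖u' a‖ ^ 2) := by
    intro i hi a ha b hb
    have hsub : Icc (t i) (t (i + 1)) ⊆ Icc (t 0) (t k) :=
      Icc_subset_Icc (htm i hi.le 0 (Nat.zero_le i)) (htm k le_rfl (i + 1) hi)
    exact soninEnergy_le_mul_ratio (fun z hz => hu z (hsub hz)) (fun z hz => hφ z (hsub hz))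
      (hmono i hi) hmin (fun z hz => hbd z (hsub hz)) ha hb
  -- induction on the number of stretches
  have key : ∀ n ≤ k, ∀ a ∈ Icc (t 0) (t n), ∀ b ∈ Icc (t 0) (t n),
      φ b * ‖u b‖ ^ 2 + ‖u' b‖ ^ 2 ≤ (φmax / φmin) ^ n * (φ a * ‖u a‖ ^ 2 + ‖u' a‖ ^ 2) := by
    intro n
    induction n with
    | zero =>
      intro _ a ha b hb
      have hab : a = b := le_antisymm (ha.2.trans hb.1) (hb.2.trans ha.1)
      subst hab
      rw [pow_zero, one_mul]
    | succ n ih =>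
      intro hn a ha b hb
      have hn' : n < k := hn
      have hsub : Icc (t 0) (t (n + 1)) ⊆ Icc (t 0) (t k) :=
        Icc_subset_Icc_right (htm k le_rfl (n + 1) hn)
      have h0n : t 0 ≤ t n := htm n hn'.le 0 (Nat.zero_le n)
      have hnn : t n ≤ t (n + 1) := ht n hn'
      have hs : t n ∈ Icc (t 0) (t n) := right_mem_Icc.2 h0n
      have hs' : t n ∈ Icc (t n) (t (n + 1)) := left_mem_Icc.2 hnn
      have hEa : 0 ≤ φ a * ‖u a‖ ^ 2 + ‖u' a‖ ^ 2 := hE0 a (hsub ha)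
      have hrn : 1 ≤ (φmax / φmin) ^ n := one_le_pow₀ hr
      rcases le_total a (t n) with has | hsa <;> rcases le_total b (t n) with hbs | hsb
      · -- both points in `[t 0, t n]`
        calc φ b * ‖u b‖ ^ 2 + ‖u' b‖ ^ 2
            ≤ (φmax / φmin) ^ n * (φ a * ‖u a‖ ^ 2 + ‖u' a‖ ^ 2) :=
              ih hn'.le a ⟨ha.1, has⟩ b ⟨hb.1, hbs⟩
          _ ≤ (φmax / φmin) ^ (n + 1) * (φ a * ‖u a‖ ^ 2 + ‖u' a‖ ^ 2) := by
              rw [pow_succ]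
              exact mul_le_mul_of_nonneg_right
                (le_mul_of_one_le_right (pow_nonneg hr0 n) hr) hEa
      · -- `a ≤ t n ≤ b`: induction up to `t n`, then the last stretch
        calc φ b * ‖u b‖ ^ 2 + ‖u' b‖ ^ 2
            ≤ φmax / φmin * (φ (t n) * ‖u (t n)‖ ^ 2 + ‖u' (t n)‖ ^ 2) :=
              hone n hn' (t n) hs' b ⟨hsb, hb.2⟩
          _ ≤ φmax / φmin * ((φmax / φmin) ^ n * (φ a * ‖u a‖ ^ 2 + ‖u' a‖ ^ 2)) :=
              mul_le_mul_of_nonneg_left (ih hn'.le a ⟨ha.1, has⟩ (t n) hs) hr0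
          _ = (φmax / φmin) ^ (n + 1) * (φ a * ‖u a‖ ^ 2 + ‖u' a‖ ^ 2) := by ring
      · -- `b ≤ t n ≤ a`: the last stretch down to `t n`, then induction
        calc φ b * ‖u b‖ ^ 2 + ‖u' b‖ ^ 2
            ≤ (φmax / φmin) ^ n * (φ (t n) * ‖u (t n)‖ ^ 2 + ‖u' (t n)‖ ^ 2) :=
              ih hn'.le (t n) hs b ⟨hb.1, hbs⟩
          _ ≤ (φmax / φmin) ^ n * (φmax / φmin * (φ a * ‖u a‖ ^ 2 + ‖u' a‖ ^ 2)) :=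
              mul_le_mul_of_nonneg_left (hone n hn' a ⟨hsa, ha.2⟩ (t n) hs') (pow_nonneg hr0 n)
          _ = (φmax / φmin) ^ (n + 1) * (φ a * ‖u a‖ ^ 2 + ‖u' a‖ ^ 2) := by ring
      · -- both points in the last stretch
        calc φ b * ‖u b‖ ^ 2 + ‖u' b‖ ^ 2
            ≤ φmax / φmin * (φ a * ‖u a‖ ^ 2 + ‖u' a‖ ^ 2) :=
              hone n hn' a ⟨hsa, ha.2⟩ b ⟨hsb, hb.2⟩
          _ ≤ (φmax / φmin) ^ (n + 1) * (φ a * ‖u a‖ ^ 2 + ‖u' a‖ ^ 2) := by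
              rw [pow_succ]
              exact mul_le_mul_of_nonneg_right (le_mul_of_one_le_left hr0 hrn) hEa
  exact key k le_rfl x hx y hy

end Literature.Analysis.ODE

end
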